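import Summits.HodgeConjecture.HodgeConjecture.Theorems.K2E1BLSpacesU2                          -- ★ p858804 P2a A (imports ★ p858761 leaf of record): `cnstN`, `HNcusp`, …
import Literature.NumberTheory.Automorphic.UnitaryGroupBorelConstantTermInvariance              -- ★ `borelConstantTerm_rational_borel_mul` (the `T(F)` product-formula lemma)
import Literature.NumberTheory.Automorphic.UnitaryGroupUnipotentUnimodularThree               -- ★ `borelConstantTerm_unipotent_mul_of_isMulRightInvariant`
import Literature.NumberTheory.Automorphic.UnitaryGroupBorelPair                              -- ★ `adelicUnipotent_le_borelAdelic`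
import Literature.NumberTheory.Automorphic.UnitaryGroupBorelHeightContinuous                  -- ★ `continuous_borelHeight`
import Mathlib.MeasureTheory.Function.ConditionalExpectation.Basic                            -- Mathlib `condExp`, `ae_eq_condExp_of_forall_setIntegral_eq`
import HarnessLib

/-!
# The constant-term projection `cnst_k` on `𝓗_k(Z_c)`, `Z = B(F)∖G(𝔸_F)`, IS the fibre average over `N(F)∖N(𝔸)`:
# `cnst_k (toHN φ) = toHN (φ_B)` — Bernstein–Lapid §4 Claim 4, bullets 3–4

(Bernstein–Lapid, arXiv:1911.02342 = J. AMS 37 (2024), §4 Claim 4 p. 10: «the constant term map defines an orthogonal projection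
`cnst_N` of `𝓗_N(Z)` onto the closed subspace of functions that factor through `y`»; Mœglin–Waldspurger (1995), I.2.6.)

Topic `NumberTheory/Automorphic`; crux H413, cell `pub/hodgecm-mathlib`, campaign «EIS-R7-BL-SPH-2», deal «BL-P2b» (K2E1-plan (g5)
2026-09-04T09:05:12Z), RULING «Z := B(F)∖G(𝔸)» (leaf of record ★ `K2E1BLBorelSpacesU2Defs`). THEOREMS ONLY over accepted tree
modules (no definition, no named fact, no instance, no notation, no `sorry`).

THE DEFINITIONS (★ leaf). `Z = borelQuotient`, `π = toBorelQuotient`, `zFun φ` (the function on `Z` of a left-`B(F)`-invariant `φ`),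
`qN : Z → N(𝔸)B(F)∖G(𝔸)` and the INVARIANT σ-ALGEBRA `mN = invariantSigma = comap qN (borel)`, the weighted truncated measure
`μw = weightedTruncMeasure k c μZ`, `𝓗_k(Z_c) = HN k c μZ = L²(μw)`, and `cnst_k = cnstN k c μZ := subtypeL ∘ condExpL2 ℂ ℂ (mN ≤ Borel)` —
the orthogonal projection onto the `mN`-measurable classes. The fibre average is ★ `borelConstantTerm ν 𝓕 φ g = ν(𝓕)⁻¹ ∫_𝓕 φ(ug) dν(u)`.

THE ARGUMENT. (1) `mN`-sets are `qN`-SATURATED: `s = qN⁻¹B`, so the lift `π⁻¹s ⊆ G(𝔸)` is left-`N(𝔸)B(F)`-invariant POINTWISE and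
`(φ·𝟙_{π⁻¹s})_B = φ_B·𝟙_{π⁻¹s}` (§1, §3). (2) `φ_B` is left-`N(𝔸)B(F)`-invariant (★ `borelConstantTerm_unipotent_mul_of_isMulRightInvariant`
and ★ `borelConstantTerm_rational_borel_mul` — the `T(F)` product-formula lemma), so for CONTINUOUS `φ_B` the function `zFun φ_B` descends
continuously to the base and is `mN`-strongly measurable (§1). (3) The DISINTEGRATION LETTER `hdis` — «`μw` is invariant under fibre
averaging»: `∫_Z zFun(Φ_B) dμw = ∫_Z zFun(Φ) dμw` for left-`B(F)`-invariant integrable `Φ` — applied to `Φ = φ·𝟙_{π⁻¹s}` gives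
`∫_s zFun φ_B = ∫_s zFun φ` on every `mN`-set; Mathlib's `ae_eq_condExp_of_forall_setIntegral_eq` + `MemLp.condExpL2_ae_eq_condExp'` then
identify `cnst_k(toHN φ)` with `toHN φ_B` (§2–§3). (4) Kernel reading: `toHN φ ∈ 𝓗^cusp ↔ zFun φ_B = 0` `μw`-a.e. (§4).

* §1 `measurableSet_invariantSigma_iff`, `qN_toBorelQuotient_mul`, `continuous_borelQuotHeight`, `forall_mem_adelicUnipBorelSubgroup_mul_eq`, `zFun_indicator_preimage`,
  **`aestronglyMeasurable_invariantSigma_zFun`**, `borelConstantTerm_adelicUnipBorel_mul` (invariance of `φ_B` under `N(𝔸)B(F)`).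
* §2 **`cnstN_toHN_eq_toHN_of_forall_setIntegral_eq`** — the generic identification (any `ψ` that is `mN`-measurable with the right set integrals).
* §3 `borelConstantTerm_indicator_preimage`, `setIntegral_zFun_borelConstantTerm_eq` (from `hdis`), **`cnstN_toHN_eq_toHN_borelConstantTerm`** ((i)).
* §4 **`toHN_mem_HNcusp_iff_ae`** ((iii)), `toHN_mem_HNcusp_of_forall_eq_zero`.
NOT HERE (FILE B): the commutation `cnst_k ∘ δ_{c,c₀}(h) = δ_{c,c₀}(h) ∘ cnst_k` and with `restrHN`.

## References
* J. Bernstein, E. Lapid, *On the meromorphic continuation of Eisenstein series*, arXiv:1911.02342, J. AMS 37 (2024): §4 Claim 4 (p. 10) [BernsteinLapid2019].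
* C. Mœglin, J.-L. Waldspurger, *Spectral Decomposition and Eisenstein Series*, CUP (1995): I.2.6 [MoeglinWaldspurger1995].
-/

set_option autoImplicit false
set_option linter.dupNamespace false

noncomputable section

open MeasureTheory Measure NumberField IsDedekindDomain Set Filter Topology
open scoped ENNReal NNReal
open Literature.NumberTheory.Automorphic Literature.NumberTheory.Automorphic.UnitaryGroup AdelicGroupData
open Summit.HodgeConjecture.HodgeConjecture.Cruxes.H413.K2E1BLBorelSpacesU2Defs

namespace Summit.HodgeConjecture.HodgeConjecture.Cruxes.H413.K2E1BLConstantTermProjectionU2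

variable {F E : Type} [Field F] [NumberField F] [Field E] [NumberField E] [Algebra F E] {c : E ≃ₐ[F] E} {N : ℕ}

/-! ## §1 The invariant σ-algebra: saturated sets, invariant functions, measurability by descent -/

/-- `mN`-measurable sets are exactly the `qN`-saturated Borel pull-backs `qN⁻¹B`. [cite: BernsteinLapid2019, §4 Claim 4 p. 10] -/
theorem measurableSet_invariantSigma_iff (s : Set (borelQuotient F E c N)) :
    MeasurableSet[invariantSigma F E c N] s ↔ ∃ B : Set (adelicBorelQuotient F E c N), MeasurableSet[borel _] B ∧ qN F E c N ⁻¹' B = s :=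
  MeasurableSpace.measurableSet_comap

/-- `qN (π (x g)) = qN (π g)` for `x ∈ N(𝔸)B(F)`. [cite: BernsteinLapid2019, §4 Claim 4 p. 10] -/
theorem qN_toBorelQuotient_mul {x : (quasiSplit F E c N).Adelic} (hx : x ∈ adelicUnipBorelSubgroup F E c N)
    (g : (quasiSplit F E c N).Adelic) :
    qN F E c N (toBorelQuotient F E c N (x * g)) = qN F E c N (toBorelQuotient F E c N g) :=
  Quotient.sound ⟨⟨x, hx⟩, rfl⟩

/-- Membership in a saturated set is invariant: `π (x g) ∈ qN⁻¹B ↔ π g ∈ qN⁻¹B` for `x ∈ N(𝔸)B(F)`. [cite: BernsteinLapid2019, §4 Claim 4 p. 10] -/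
theorem toBorelQuotient_mul_mem_iff {s : Set (borelQuotient F E c N)} (hs : MeasurableSet[invariantSigma F E c N] s)
    {x : (quasiSplit F E c N).Adelic} (hx : x ∈ adelicUnipBorelSubgroup F E c N) (g : (quasiSplit F E c N).Adelic) :
    toBorelQuotient F E c N (x * g) ∈ s ↔ toBorelQuotient F E c N g ∈ s := by
  obtain ⟨B, -, rfl⟩ := (measurableSet_invariantSigma_iff s).1 hs
  simp only [mem_preimage, qN_toBorelQuotient_mul hx g]

/-- Invariance under `N(𝔸)` and under `B(F)` gives invariance under `N(𝔸)B(F) = N(𝔸) ⊔ B(F)` (the invariance set is a subgroup).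
[cite: BernsteinLapid2019, §4 Claim 4 p. 10] -/
theorem forall_mem_adelicUnipBorelSubgroup_mul_eq {X : Type*} {Ψ : (quasiSplit F E c N).Adelic → X}
    (hN : ∀ u : adelicUnipotent F E c N, ∀ g, Ψ ((u : (quasiSplit F E c N).Adelic) * g) = Ψ g)
    (hB : ∀ b ∈ ratBorelSubgroup F E c N, ∀ g, Ψ (b * g) = Ψ g) :
    ∀ x ∈ adelicUnipBorelSubgroup F E c N, ∀ g, Ψ (x * g) = Ψ g := by
  let S : Subgroup (quasiSplit F E c N).Adelic :=
    { carrier := {x | ∀ g, Ψ (x * g) = Ψ g}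
      mul_mem' := fun {a b} ha hb g => by rw [mul_assoc, ha, hb]
      one_mem' := fun g => by rw [one_mul]
      inv_mem' := fun {a} ha g => by rw [← ha (a⁻¹ * g), mul_inv_cancel_left] }
  have hle : adelicUnipBorelSubgroup F E c N ≤ S :=
    sup_le (fun u hu => hN ⟨u, hu⟩) (fun b hb => hB b hb)
  exact fun x hx => hle hx

/-- `zFun` of a lifted indicator: `zFun ((π⁻¹s)·φ) = 𝟙_s · zFun φ` (pointwise, any `φ`). [cite: BernsteinLapid2019, §4 Claim 4 p. 10] -/
theorem zFun_indicator_preimage (s : Set (borelQuotient F E c N)) (φ : (quasiSplit F E c N).Adelic → ℂ) :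
    zFun F E c N ((toBorelQuotient F E c N ⁻¹' s).indicator φ) = s.indicator (zFun F E c N φ) := by
  funext z
  have hz : toBorelQuotient F E c N
      (Quotient.out (z : Quotient (MulAction.orbitRel (ratBorelSubgroup F E c N) (quasiSplit F E c N).Adelic))) = z :=
    Quotient.out_eq _
  by_cases h : z ∈ s
  · rw [indicator_of_mem h]
    show (toBorelQuotient F E c N ⁻¹' s).indicator φ _ = φ _
    rw [indicator_of_mem (show _ ∈ toBorelQuotient F E c N ⁻¹' s by rw [mem_preimage, hz]; exact h)]
  · rw [indicator_of_notMem h]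
    show (toBorelQuotient F E c N ⁻¹' s).indicator φ _ = 0
    rw [indicator_of_notMem (show _ ∉ toBorelQuotient F E c N ⁻¹' s by rw [mem_preimage, hz]; exact h)]

/-- The height `HZ` on `Z` is continuous (★ `continuous_borelHeight` descends along the quotient map). [cite: BernsteinLapid2019, §4 p. 9] -/
theorem continuous_borelQuotHeight [NeZero N] : Continuous (borelQuotHeight F E c N) :=
  (continuous_borelHeight (F := F) (E := E) (c := c) (N := N)).quotient_lift _

/-- **`mN`-measurability by descent.** A CONTINUOUS left-`N(𝔸)B(F)`-invariant `Ψ : G(𝔸) → ℂ` descends continuously to the base `N(𝔸)B(F)∖G(𝔸)`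
(a topological quotient OF `G(𝔸)`), so `zFun Ψ = Ψ̃ ∘ qN` is strongly measurable for the invariant σ-algebra `mN = comap qN (borel)`, for any measure.
[cite: BernsteinLapid2019, §4 Claim 4 p. 10] -/
theorem aestronglyMeasurable_invariantSigma_zFun {Ψ : (quasiSplit F E c N).Adelic → ℂ}
    (hΨ : ∀ x ∈ adelicUnipBorelSubgroup F E c N, ∀ g, Ψ (x * g) = Ψ g) (hΨc : Continuous Ψ) (μ : Measure (borelQuotient F E c N)) :
    AEStronglyMeasurable[invariantSigma F E c N] (zFun F E c N Ψ) μ := by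
  -- descend to the base
  let Ψb : adelicBorelQuotient F E c N → ℂ :=
    Quotient.lift Ψ fun a b (hab : MulAction.orbitRel (adelicUnipBorelSubgroup F E c N) _ a b) => by
      obtain ⟨x, rfl⟩ := hab
      exact hΨ x x.2 b
  have hcont : Continuous Ψb := hΨc.quotient_lift _
  have hB : ∀ γ ∈ ratBorelSubgroup F E c N, ∀ g, Ψ (γ * g) = Ψ g :=
    fun γ hγ g => hΨ γ (ratBorelSubgroup_le_adelicUnipBorelSubgroup F E c N hγ) g
  have heq : zFun F E c N Ψ = Ψb ∘ qN F E c N := by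
    funext z
    obtain ⟨g, rfl⟩ := Quotient.exists_rep
      (z : Quotient (MulAction.orbitRel (ratBorelSubgroup F E c N) (quasiSplit F E c N).Adelic))
    exact zFun_toBorelQuotient F E c N hB g
  letI mB : MeasurableSpace (adelicBorelQuotient F E c N) := borel _
  haveI : BorelSpace (adelicBorelQuotient F E c N) := ⟨rfl⟩
  have hmeas : Measurable[invariantSigma F E c N] (zFun F E c N Ψ) := by
    rw [heq]
    exact hcont.measurable.comp (measurable_iff_comap_le.2 le_rfl)
  exact ⟨zFun F E c N Ψ, hmeas.stronglyMeasurable, EventuallyEq.rfl⟩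

section ConstantTermInvariance

variable [NeZero N] [MeasurableSpace (adelicUnipotent F E c N)] [BorelSpace (adelicUnipotent F E c N)]

omit [NeZero N] [MeasurableSpace (adelicUnipotent F E c N)] [BorelSpace (adelicUnipotent F E c N)] in
/-- Bridge: `b ∈ B(F)` (leaf letter `ratBorelSubgroup`) iff `⟨b, _⟩ ∈ arithmeticBorel` (★ letter). [cite: BernsteinLapid2019, §4 p. 9] -/
theorem mem_arithmeticBorel_of_mem_ratBorelSubgroup {b : (quasiSplit F E c N).Adelic} (hb : b ∈ ratBorelSubgroup F E c N) :
    (⟨b, ratBorelSubgroup_le_arithmeticSubgroup F E c N hb⟩ : (quasiSplit F E c N).arithmeticSubgroup) ∈ arithmeticBorel F E c N :=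
  (mem_arithmeticBorel_iff _).2 hb.1

omit [NeZero N] in
/-- **The fibre average `φ_B` of a left-`B(F)`-invariant `φ` is left-`N(𝔸)B(F)`-invariant** (Haar `ν` right-invariant on the unimodular
`N(𝔸)`, `𝓕` a fundamental domain of `N(F)`): `N(𝔸)`-invariance ★ `borelConstantTerm_unipotent_mul_of_isMulRightInvariant`, `B(F)`-invariance ★
`borelConstantTerm_rational_borel_mul` (the `T(F)` product-formula lemma: `T(F)` normalises `N(𝔸)` with module `1`). [cite: MoeglinWaldspurger1995, I.2.6]
[cite: BernsteinLapid2019, §4 Claim 4 p. 10] -/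
theorem borelConstantTerm_adelicUnipBorel_mul (ν : Measure (adelicUnipotent F E c N)) [ν.IsHaarMeasure] [ν.IsMulRightInvariant]
    {𝓕 : Set (adelicUnipotent F E c N)} (h𝓕 : IsFundamentalDomain (rationalUnipotent F E c N) 𝓕 ν)
    {φ : (quasiSplit F E c N).Adelic → ℂ} (hφB : ∀ b ∈ ratBorelSubgroup F E c N, ∀ g, φ (b * g) = φ g) :
    ∀ x ∈ adelicUnipBorelSubgroup F E c N, ∀ g, borelConstantTerm ν 𝓕 φ (x * g) = borelConstantTerm ν 𝓕 φ g := by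
  refine forall_mem_adelicUnipBorelSubgroup_mul_eq (fun u g => ?_) (fun b hb g => ?_)
  · refine borelConstantTerm_unipotent_mul_of_isMulRightInvariant ν h𝓕 (fun u' hu' x => hφB _ ⟨?_, ?_⟩ x) u g
    · exact adelicUnipotent_le_borelAdelic u'.2
    · exact Subgroup.mem_comap.1 hu'
  · have h := borelConstantTerm_rational_borel_mul ν h𝓕 (φ := φ)
      (fun b' hb' x => hφB _ ⟨(mem_arithmeticBorel_iff b').1 hb', b'.2⟩ x)
      ⟨b, ratBorelSubgroup_le_arithmeticSubgroup F E c N hb⟩ (mem_arithmeticBorel_of_mem_ratBorelSubgroup hb) g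
    exact h

end ConstantTermInvariance

/-! ## §2 The generic identification: `cnst_k (toHN φ) = toHN ψ` from `mN`-measurability of `ψ` and the set integrals on `mN`-sets -/

section Identification

variable [NeZero N] (k : ℕ) (c₁ : ℝ≥0) (μZ : Measure (borelQuotient F E c N))

/-- **`cnst_k (toHN φ) = toHN ψ`** as soon as `zFun ψ` is `mN`-a.e.-strongly measurable and has the same integrals as `zFun φ` over every
`mN`-set — the SET-INTEGRAL CHARACTERISATION of the conditional expectation (Mathlib `ae_eq_condExp_of_forall_setIntegral_eq`,
`MemLp.condExpL2_ae_eq_condExp'`), for `μw = weightedTruncMeasure k c μZ` finite (K2E1-p08: `isFiniteMeasure_weightedTruncMeasure_cm`).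
[cite: BernsteinLapid2019, §4 Claim 4 p. 10] -/
theorem cnstN_toHN_eq_toHN_of_forall_setIntegral_eq [IsFiniteMeasure (weightedTruncMeasure F E c N k c₁ μZ)]
    {φ ψ : (quasiSplit F E c N).Adelic → ℂ} (hφ2 : MemLp (zFun F E c N φ) 2 (weightedTruncMeasure F E c N k c₁ μZ))
    (hψ2 : MemLp (zFun F E c N ψ) 2 (weightedTruncMeasure F E c N k c₁ μZ))
    (hψm : AEStronglyMeasurable[invariantSigma F E c N] (zFun F E c N ψ) (weightedTruncMeasure F E c N k c₁ μZ))
    (hset : ∀ s, MeasurableSet[invariantSigma F E c N] s → weightedTruncMeasure F E c N k c₁ μZ s < ∞ →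
      ∫ x in s, zFun F E c N ψ x ∂weightedTruncMeasure F E c N k c₁ μZ = ∫ x in s, zFun F E c N φ x ∂weightedTruncMeasure F E c N k c₁ μZ) :
    cnstN F E c N k c₁ μZ (toHN F E c N k c₁ μZ φ hφ2) = toHN F E c N k c₁ μZ ψ hψ2 := by
  have hφ1 : Integrable (zFun F E c N φ) (weightedTruncMeasure F E c N k c₁ μZ) := hφ2.integrable one_le_two
  have h1 : ((cnstN F E c N k c₁ μZ (toHN F E c N k c₁ μZ φ hφ2) : HN F E c N k c₁ μZ) : borelQuotient F E c N → ℂ)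
      =ᵐ[weightedTruncMeasure F E c N k c₁ μZ] (weightedTruncMeasure F E c N k c₁ μZ)[zFun F E c N φ | invariantSigma F E c N] :=
    hφ2.condExpL2_ae_eq_condExp' (E := ℂ) (𝕜 := ℂ) (invariantSigma_le F E c N) hφ1
  have h2 : zFun F E c N ψ =ᵐ[weightedTruncMeasure F E c N k c₁ μZ]
      (weightedTruncMeasure F E c N k c₁ μZ)[zFun F E c N φ | invariantSigma F E c N] :=
    ae_eq_condExp_of_forall_setIntegral_eq (invariantSigma_le F E c N) hφ1
      (fun s hs _ => (hψ2.integrable one_le_two).integrableOn) hset hψm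
  exact Lp.ext (h1.trans (h2.symm.trans (coeFn_toHN F E c N k c₁ μZ ψ hψ2).symm))

end Identification

/-! ## §3 (i) `cnst_k (toHN φ) = toHN (φ_B)` under the disintegration letter -/

section Disintegration

variable [NeZero N] [MeasurableSpace (adelicUnipotent F E c N)]
variable (ν : Measure (adelicUnipotent F E c N)) (𝓕 : Set (adelicUnipotent F E c N)) (k : ℕ) (c₁ : ℝ≥0)
  (μZ : Measure (borelQuotient F E c N))

omit [NeZero N] in
/-- **Saturated indicators pass through the fibre average**: for an `mN`-set `s`, `(𝟙_{π⁻¹s}·φ)_B = 𝟙_{π⁻¹s}·φ_B` (pointwise; `π(ug) ∈ s ↔ π g ∈ s`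
for `u ∈ N(𝔸)`). [cite: BernsteinLapid2019, §4 Claim 4 p. 10] -/
theorem borelConstantTerm_indicator_preimage {s : Set (borelQuotient F E c N)} (hs : MeasurableSet[invariantSigma F E c N] s)
    (φ : (quasiSplit F E c N).Adelic → ℂ) :
    borelConstantTerm ν 𝓕 ((toBorelQuotient F E c N ⁻¹' s).indicator φ) = (toBorelQuotient F E c N ⁻¹' s).indicator (borelConstantTerm ν 𝓕 φ) := by
  funext g
  have hmem : ∀ u : adelicUnipotent F E c N,
      (u : (quasiSplit F E c N).Adelic) * g ∈ toBorelQuotient F E c N ⁻¹' s ↔ g ∈ toBorelQuotient F E c N ⁻¹' s :=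
    fun u => toBorelQuotient_mul_mem_iff hs (Subgroup.mem_sup_left u.2) g
  by_cases hg : g ∈ toBorelQuotient F E c N ⁻¹' s
  · rw [indicator_of_mem hg, borelConstantTerm_def, borelConstantTerm_def]
    congr 1
    refine integral_congr_ae (Eventually.of_forall fun u => ?_)
    exact indicator_of_mem ((hmem u).2 hg) φ
  · rw [indicator_of_notMem hg, borelConstantTerm_def]
    have h0 : (fun u : adelicUnipotent F E c N => (toBorelQuotient F E c N ⁻¹' s).indicator φ ((u : (quasiSplit F E c N).Adelic) * g)) =
        fun _ => 0 := funext fun u => indicator_of_notMem (fun h => hg ((hmem u).1 h)) φ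
    rw [h0, integral_zero, smul_zero]

/-- **The disintegration letter gives the set integrals.** `hdis` — «`μw` is invariant under fibre averaging: `∫ zFun(Φ_B) dμw = ∫ zFun(Φ) dμw` for
left-`B(F)`-invariant integrable `Φ`» (what a disintegration of `μZ` along `qN` with the normalised Haar measure of `N(F)∖N(𝔸)` on the fibres gives,
the weight and the truncation being fibre-constant) — applied to `Φ = 𝟙_{π⁻¹s}·φ` yields `∫_s zFun φ_B = ∫_s zFun φ` on every `mN`-set `s`.
[cite: BernsteinLapid2019, §4 Claim 4 p. 10] [cite: MoeglinWaldspurger1995, I.2.6] -/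
theorem setIntegral_zFun_borelConstantTerm_eq
    (hdis : ∀ Φ : (quasiSplit F E c N).Adelic → ℂ, (∀ b ∈ ratBorelSubgroup F E c N, ∀ g, Φ (b * g) = Φ g) →
      Integrable (zFun F E c N Φ) (weightedTruncMeasure F E c N k c₁ μZ) →
      Integrable (zFun F E c N (borelConstantTerm ν 𝓕 Φ)) (weightedTruncMeasure F E c N k c₁ μZ) →
        ∫ z, zFun F E c N (borelConstantTerm ν 𝓕 Φ) z ∂weightedTruncMeasure F E c N k c₁ μZ =
          ∫ z, zFun F E c N Φ z ∂weightedTruncMeasure F E c N k c₁ μZ)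
    {φ : (quasiSplit F E c N).Adelic → ℂ} (hφB : ∀ b ∈ ratBorelSubgroup F E c N, ∀ g, φ (b * g) = φ g)
    (hφ1 : Integrable (zFun F E c N φ) (weightedTruncMeasure F E c N k c₁ μZ))
    (hψ1 : Integrable (zFun F E c N (borelConstantTerm ν 𝓕 φ)) (weightedTruncMeasure F E c N k c₁ μZ))
    {s : Set (borelQuotient F E c N)} (hs : MeasurableSet[invariantSigma F E c N] s) :
    ∫ x in s, zFun F E c N (borelConstantTerm ν 𝓕 φ) x ∂weightedTruncMeasure F E c N k c₁ μZ =
      ∫ x in s, zFun F E c N φ x ∂weightedTruncMeasure F E c N k c₁ μZ := by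
  have hs' : MeasurableSet s := invariantSigma_le F E c N s hs
  have hΦB : ∀ b ∈ ratBorelSubgroup F E c N, ∀ g,
      (toBorelQuotient F E c N ⁻¹' s).indicator φ (b * g) = (toBorelQuotient F E c N ⁻¹' s).indicator φ g := by
    intro b hb g
    have hmem : b * g ∈ toBorelQuotient F E c N ⁻¹' s ↔ g ∈ toBorelQuotient F E c N ⁻¹' s :=
      toBorelQuotient_mul_mem_iff hs (ratBorelSubgroup_le_adelicUnipBorelSubgroup F E c N hb) g
    by_cases h : g ∈ toBorelQuotient F E c N ⁻¹' s
    · rw [indicator_of_mem h, indicator_of_mem (hmem.2 h), hφB b hb g]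
    · rw [indicator_of_notMem h, indicator_of_notMem (fun h' => h (hmem.1 h'))]
  have h1 : zFun F E c N ((toBorelQuotient F E c N ⁻¹' s).indicator φ) = s.indicator (zFun F E c N φ) :=
    zFun_indicator_preimage s φ
  have h2 : zFun F E c N (borelConstantTerm ν 𝓕 ((toBorelQuotient F E c N ⁻¹' s).indicator φ)) =
      s.indicator (zFun F E c N (borelConstantTerm ν 𝓕 φ)) := by
    rw [borelConstantTerm_indicator_preimage ν 𝓕 hs φ, zFun_indicator_preimage]
  have h := hdis _ hΦB (by rw [h1]; exact hφ1.indicator hs') (by rw [h2]; exact hψ1.indicator hs')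
  rw [h1, h2, integral_indicator hs', integral_indicator hs'] at h
  exact h

variable [BorelSpace (adelicUnipotent F E c N)]

/-- **(i) THE IDENTIFICATION `cnst_k (toHN φ) = toHN (φ_B)`** [BernsteinLapid2019, §4 Claim 4 bullets 3–4]. Letters: `ν` a Haar measure on the
unimodular `N(𝔸)` and `𝓕` a fundamental domain of `N(F)` (so `φ_B = borelConstantTerm ν 𝓕 φ` is the fibre average), `μw = weightedTruncMeasure k c μZ`
finite, the disintegration letter `hdis` (see `setIntegral_zFun_borelConstantTerm_eq`), `φ` left-`B(F)`-invariant with `zFun φ, zFun φ_B ∈ L²(μw)` and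
`φ_B` continuous. Then the orthogonal projection `cnst_k` maps the class of `φ` to the class of `φ_B`. [cite: BernsteinLapid2019, §4 Claim 4 p. 10]
[cite: MoeglinWaldspurger1995, I.2.6] -/
theorem cnstN_toHN_eq_toHN_borelConstantTerm [ν.IsHaarMeasure] [ν.IsMulRightInvariant]
    (h𝓕 : IsFundamentalDomain (rationalUnipotent F E c N) 𝓕 ν) [IsFiniteMeasure (weightedTruncMeasure F E c N k c₁ μZ)]
    (hdis : ∀ Φ : (quasiSplit F E c N).Adelic → ℂ, (∀ b ∈ ratBorelSubgroup F E c N, ∀ g, Φ (b * g) = Φ g) →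
      Integrable (zFun F E c N Φ) (weightedTruncMeasure F E c N k c₁ μZ) →
      Integrable (zFun F E c N (borelConstantTerm ν 𝓕 Φ)) (weightedTruncMeasure F E c N k c₁ μZ) →
        ∫ z, zFun F E c N (borelConstantTerm ν 𝓕 Φ) z ∂weightedTruncMeasure F E c N k c₁ μZ =
          ∫ z, zFun F E c N Φ z ∂weightedTruncMeasure F E c N k c₁ μZ)
    {φ : (quasiSplit F E c N).Adelic → ℂ} (hφB : ∀ b ∈ ratBorelSubgroup F E c N, ∀ g, φ (b * g) = φ g)
    (hφ2 : MemLp (zFun F E c N φ) 2 (weightedTruncMeasure F E c N k c₁ μZ))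
    (hψ2 : MemLp (zFun F E c N (borelConstantTerm ν 𝓕 φ)) 2 (weightedTruncMeasure F E c N k c₁ μZ))
    (hψc : Continuous (borelConstantTerm ν 𝓕 φ)) :
    cnstN F E c N k c₁ μZ (toHN F E c N k c₁ μZ φ hφ2) = toHN F E c N k c₁ μZ (borelConstantTerm ν 𝓕 φ) hψ2 :=
  cnstN_toHN_eq_toHN_of_forall_setIntegral_eq k c₁ μZ hφ2 hψ2
    (aestronglyMeasurable_invariantSigma_zFun (borelConstantTerm_adelicUnipBorel_mul ν h𝓕 hφB) hψc _)
    (fun _ hs _ => setIntegral_zFun_borelConstantTerm_eq ν 𝓕 k c₁ μZ hdis hφB (hφ2.integrable one_le_two)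
      (hψ2.integrable one_le_two) hs)

/-! ## §4 (iii) The kernel reading: `toHN φ ∈ 𝓗_k(Z_c)^cusp ↔ φ_B = 0` a.e. on `Z_c` -/

/-- **(iii) KERNEL READING** (same letters as (i)): `toHN φ ∈ HNcusp ↔ zFun φ_B = 0` `μw`-a.e., i.e. the cuspidal part of `𝓗_k(Z_c)` is cut out by the
vanishing of the fibre average `∫_{N(F)∖N(𝔸)} φ(n·) dn` above the height `c` (K1-L²'s classical reading). [cite: BernsteinLapid2019, §4 Claim 5 p. 10] -/
theorem toHN_mem_HNcusp_iff_ae [ν.IsHaarMeasure] [ν.IsMulRightInvariant]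
    (h𝓕 : IsFundamentalDomain (rationalUnipotent F E c N) 𝓕 ν) [IsFiniteMeasure (weightedTruncMeasure F E c N k c₁ μZ)]
    (hdis : ∀ Φ : (quasiSplit F E c N).Adelic → ℂ, (∀ b ∈ ratBorelSubgroup F E c N, ∀ g, Φ (b * g) = Φ g) →
      Integrable (zFun F E c N Φ) (weightedTruncMeasure F E c N k c₁ μZ) →
      Integrable (zFun F E c N (borelConstantTerm ν 𝓕 Φ)) (weightedTruncMeasure F E c N k c₁ μZ) →
        ∫ z, zFun F E c N (borelConstantTerm ν 𝓕 Φ) z ∂weightedTruncMeasure F E c N k c₁ μZ =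
          ∫ z, zFun F E c N Φ z ∂weightedTruncMeasure F E c N k c₁ μZ)
    {φ : (quasiSplit F E c N).Adelic → ℂ} (hφB : ∀ b ∈ ratBorelSubgroup F E c N, ∀ g, φ (b * g) = φ g)
    (hφ2 : MemLp (zFun F E c N φ) 2 (weightedTruncMeasure F E c N k c₁ μZ))
    (hψ2 : MemLp (zFun F E c N (borelConstantTerm ν 𝓕 φ)) 2 (weightedTruncMeasure F E c N k c₁ μZ))
    (hψc : Continuous (borelConstantTerm ν 𝓕 φ)) :
    toHN F E c N k c₁ μZ φ hφ2 ∈ HNcusp F E c N k c₁ μZ ↔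
      zFun F E c N (borelConstantTerm ν 𝓕 φ) =ᵐ[weightedTruncMeasure F E c N k c₁ μZ] 0 := by
  rw [mem_HNcusp_iff, cnstN_toHN_eq_toHN_borelConstantTerm ν 𝓕 k c₁ μZ h𝓕 hdis hφB hφ2 hψ2 hψc, Lp.eq_zero_iff_ae_eq_zero]
  have h := coeFn_toHN F E c N k c₁ μZ (borelConstantTerm ν 𝓕 φ) hψ2
  exact ⟨fun h0 => h.symm.trans h0, fun h0 => h.trans h0⟩

/-- If `φ_B` vanishes identically above the height `c` then `toHN φ` is cuspidal (the pointwise form of (iii), `⇐`).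
[cite: BernsteinLapid2019, §4 Claim 5 p. 10] -/
theorem toHN_mem_HNcusp_of_forall_eq_zero [ν.IsHaarMeasure] [ν.IsMulRightInvariant]
    (h𝓕 : IsFundamentalDomain (rationalUnipotent F E c N) 𝓕 ν) [IsFiniteMeasure (weightedTruncMeasure F E c N k c₁ μZ)]
    (hdis : ∀ Φ : (quasiSplit F E c N).Adelic → ℂ, (∀ b ∈ ratBorelSubgroup F E c N, ∀ g, Φ (b * g) = Φ g) →
      Integrable (zFun F E c N Φ) (weightedTruncMeasure F E c N k c₁ μZ) →
      Integrable (zFun F E c N (borelConstantTerm ν 𝓕 Φ)) (weightedTruncMeasure F E c N k c₁ μZ) →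
        ∫ z, zFun F E c N (borelConstantTerm ν 𝓕 Φ) z ∂weightedTruncMeasure F E c N k c₁ μZ =
          ∫ z, zFun F E c N Φ z ∂weightedTruncMeasure F E c N k c₁ μZ)
    {φ : (quasiSplit F E c N).Adelic → ℂ} (hφB : ∀ b ∈ ratBorelSubgroup F E c N, ∀ g, φ (b * g) = φ g)
    (hφ2 : MemLp (zFun F E c N φ) 2 (weightedTruncMeasure F E c N k c₁ μZ)) (hψc : Continuous (borelConstantTerm ν 𝓕 φ))
    (h0 : ∀ g, c₁ < borelHeight g → borelConstantTerm ν 𝓕 φ g = 0) :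
    toHN F E c N k c₁ μZ φ hφ2 ∈ HNcusp F E c N k c₁ μZ := by
  -- `zFun φ_B = 0` a.e. for `μw = (μZ|_{c < HZ}).withDensity w`
  have hae : zFun F E c N (borelConstantTerm ν 𝓕 φ) =ᵐ[weightedTruncMeasure F E c N k c₁ μZ] 0 := by
    have hsub : ∀ᵐ z ∂(μZ.restrict {z | c₁ < borelQuotHeight F E c N z}), zFun F E c N (borelConstantTerm ν 𝓕 φ) z = (0 : borelQuotient F E c N → ℂ) z := by
      filter_upwards [ae_restrict_mem (measurableSet_lt measurable_const (continuous_borelQuotHeight (F := F) (E := E) (c := c) (N := N)).measurable)] with z hz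
      have hout : toBorelQuotient F E c N (Quotient.out (z : Quotient (MulAction.orbitRel (ratBorelSubgroup F E c N) (quasiSplit F E c N).Adelic))) = z :=
        Quotient.out_eq _
      have hH : c₁ < borelHeight (Quotient.out (z : Quotient (MulAction.orbitRel (ratBorelSubgroup F E c N) (quasiSplit F E c N).Adelic))) := by
        rw [← borelQuotHeight_toBorelQuotient F E c N, hout]; exact hz
      exact h0 _ hH
    exact (withDensity_absolutelyContinuous _ _).ae_le hsub
  have hψ2 : MemLp (zFun F E c N (borelConstantTerm ν 𝓕 φ)) 2 (weightedTruncMeasure F E c N k c₁ μZ) :=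
    (MemLp.zero (ε := ℂ)).ae_eq hae.symm
  exact (toHN_mem_HNcusp_iff_ae ν 𝓕 k c₁ μZ h𝓕 hdis hφB hφ2 hψ2 hψc).2 hae

end Disintegration

end Summit.HodgeConjecture.HodgeConjecture.Cruxes.H413.K2E1BLConstantTermProjectionU2

end
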